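import Summits.QuantumFields.BalabanUV.Beta.MultiscaleSupMember
import Summits.QuantumFields.BalabanUV.Beta.MultiscaleGrowthCells

/-!
# `Summit.QuantumFields.BalabanUV.Beta.MultiscaleGlobalMember` — engine file 13: the GLOBAL member (3.47)₁'s SHAPE for the MODEL
# operator `levelOp` — `|G′u|_{(2+γ)} ≲ |u|_{(γ)}` in print's scale-weighted sup norms (3.41), i.e.
# `|((levelOp)⁻¹u)(x,i)| ≤ B·n(x)²·n(x)^γ·sup_y n(y)^{−γ}|u(y)|` — from the LOCAL sup member (file 9b, modulo the typed
# local-regularity datum `hreg`) by summing over source cells with a GROWTH clause («(3.47) are consequences of the local ones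
# (3.42) and Lemma 2.1» — the local ⟹ global bookkeeping, at MODEL level)

HONEST FRAMING (page 1 of everything in this cell).  Discharging `FlowStep.BetaPertH` would make Bałaban's ultraviolet
stability UNCONDITIONAL — a constructive-QFT result; it is NOT the continuum limit and NOT the Clay problem.  This module
discharges nothing of `BetaPertH`; it is [folklore] bookkeeping, kernel-checked, by the OWNER of binder row D4 (unit
`b2b-balaban-beta-an4`, gen 44).  HONEST DEPENDENCY: continuum YM on T⁴ ⇐ BetaPertH ∧ nine spine estimates (0/9 proved); BetaPertH ⇐
(D1) ∧ (D4) ∧ CAP+tail; G-an2-4 gates asym, D1 and NE2/3/4.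

THE POINT.  [B9] p. 398: «It is easy to see that the global inequalities (3.47) are consequences of the local ones (3.42) and Lemma
2.1» — no derivation printed (the cell's `B9FromB6` keeps the (3.47) entries as RESIDUAL hypotheses, GAPS G-B9-03a).  For the MODEL
operator this file makes the step explicit: the sitewise local bound of file 9b for a source localised in ONE cell, the decomposition
`u = Σ_{k′} u·1_{cell k′}` and linearity, the graded exchange of the REAL power `n(t_{k′})^γ ≤ (L^A e^{(log L/R)d_n})^{|γ|}·n(x)^γ`
(both signs of `γ`), and a GROWTH clause `#{k′ : d_n(t_k,t_{k′}) < m} ≤ N₀Λ^m` on the cell family (a THEOREM of the additive grading: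
co-owner beta-d4-p3's `MultiscaleGrowthCells.cell_growth_add`, used BY NAME in the corollary) summed by co-owner beta-d4-p2's
`MultiscaleDecayRowSums.sum_exp_neg_le_of_growth` (the (2.61)-TYPE lattice sum at MODEL level).

WHAT IS CERTIFIED (kernel, 0 sorry), in the analytic setting of `MultiscaleDecay.hc_levelOp` with graded level sides `S_l = L^{e_l}`,
the sitewise additive datum, `(1 + d/2)·log L/R ≤ κ`, file 9b's datum `hreg` (O.2 item (ii-b) — a HYPOTHESIS), a real exponent `γ` with
`δ := κ − (1 + d/2)·log L/R − |γ|·log L/R ≥ 0`: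
* `rpow_exchange` — `0 < a, b`, `1 ≤ C`, `a ≤ Cb`, `b ≤ Ca` ⟹ `a^γ ≤ C^{|γ|}·b^γ` (both signs);
* **`real_global_levelOp_inverse_le_of_growth`** — with an abstract growth clause `(N₀, Λ)` on the cells and `Λe^{−δ} < 1`: for EVERY
  `u` with `|u(q)| ≤ n(q)^γ·U` and every `p = (x,i)`:
  `|((levelOp)⁻¹u)(p)| ≤ B_sup·(L^A)^{|γ|}·e^{2dδ}·N₀Λ/(1 − Λe^{−δ})·n(x)²·n(x)^γ·U`, `B_sup = c₁K₁ + c₂K₂` of file 9b;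
* **`real_global_levelOp_inverse_le_of_grading`** — the same with the growth clause DISCHARGED by `cell_growth_add`
  (`N₀ = (3(L^A)²)^d·(d!/ε^d)·e^{2d(ε + (log L/R)d)}`, `Λ = e^{ε + 2(log L/R)d}`, free `ε > 0`).
Constants see `d, c, a, C, κ, L, A, R, ρ₀, c₁, c₂, |Cp|, γ, ε` only — print's «for γ in a fixed compact subset of real numbers».

LOCATORS (shape only, nothing printed asserted; ABSOLUTE RULE): [Balaban1985BackgroundPropagators] (3.41) + Thm 3.1 (3.42), (3.47)
pp. 397–398; [Balaban1984PropagatorsII] Lemma 2.1 (2.61) p. 234, (2.46) p. 231.  Row D4: NO class change (critical-path width 0; `hreg` NOT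
discharged; D4 DISCHARGE NO DATE); NOT BetaPertH, NOT continuum, NOT Clay, NOT summit progress.
-/

open scoped BigOperators
open Finset

namespace Summit.QuantumFields.BalabanUV.Beta.MultiscaleGlobalMember

open Summit.QuantumFields.BalabanUV.Beta.MultiscaleSupMember (real_sup_levelOp_inverse_le_of_regularity)
open Summit.QuantumFields.BalabanUV.Beta.MultiscaleCombesThomasL2CellsGraded (siteScale_ctrU)
open Summit.QuantumFields.BalabanUV.Beta.MultiscaleGrowthCells (cell_growth_add)
open Summit.QuantumFields.BalabanUV.Beta.MultiscaleDecayRowSums (sum_exp_neg_le_of_growth)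
open Summit.QuantumFields.BalabanUV.Beta.BoxPoincare (Box)
open Summit.QuantumFields.BalabanUV.Beta.MultiscaleCoerciveTorus
open Summit.QuantumFields.BalabanUV.Beta.MultiscaleDistance
open Summit.QuantumFields.BalabanUV.Beta.MultiscaleDistanceGraded (scale_le_scale_mul_exp_add)
open Summit.QuantumFields.BalabanUV.Beta.MultiscaleDistanceMetric (sdist_comm)
open Summit.QuantumFields.BalabanUV.Beta.MultiscaleDecayBudget
open Summit.QuantumFields.BalabanUV.Beta.MultiscaleDecay (decay_levelOp)
open Summit.QuantumFields.BalabanUV.Beta.AccretiveCombesThomasSandwichSite (sdist_corner_thresholds)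
open Literature.MathematicalPhysics.QuantumFieldTheory.Balaban1983to89
open Literature.MathematicalPhysics.QuantumFieldTheory.Balaban1983to89.B9Thm37GluePU (bsrc btgt)
open Literature.MathematicalPhysics.QuantumFieldTheory.Balaban1983to89.B9Thm37GlueTorusCov (tblk)
open Literature.MathematicalPhysics.QuantumFieldTheory.Balaban1983to89.B9Thm37GlueTorusCovLevels (levelOp)
open B5TorusCover (UT Ctr ctrU)

noncomputable section

/-! ## §1 The graded exchange of a real power -/

/-- **Two-sided comparability moves a real power across with `C^{|γ|}`**: `0 < a, b`, `1 ≤ C`, `a ≤ C·b`, `b ≤ C·a` ⟹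
`a^γ ≤ C^{|γ|}·b^γ` for every real `γ` (monotone branch for `γ ≥ 0`, antitone branch for `γ < 0`). [folklore] -/
theorem rpow_exchange {a b C γ : ℝ} (ha : 0 < a) (hb : 0 < b) (hC : 1 ≤ C) (hab : a ≤ C * b) (hba : b ≤ C * a) :
    a ^ γ ≤ C ^ |γ| * b ^ γ := by
  have hC0 : 0 < C := lt_of_lt_of_le one_pos hC
  by_cases hγ : 0 ≤ γ
  · rw [abs_of_nonneg hγ]
    calc a ^ γ ≤ (C * b) ^ γ := Real.rpow_le_rpow ha.le hab hγ
      _ = C ^ γ * b ^ γ := Real.mul_rpow hC0.le hb.le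
  · have hγ' : γ < 0 := lt_of_not_ge hγ
    rw [abs_of_neg hγ']
    have hle : b / C ≤ a := by rw [div_le_iff₀ hC0]; linarith [hba, mul_comm C a]
    calc a ^ γ ≤ (b / C) ^ γ := Real.rpow_le_rpow_of_nonpos (div_pos hb hC0) hle hγ'.le
      _ = b ^ γ / C ^ γ := Real.div_rpow hb.le hC0.le γ
      _ = C ^ (-γ) * b ^ γ := by rw [Real.rpow_neg hC0.le]; ring

variable {d : ℕ} {N : Fin d → ℕ} [∀ i, NeZero (N i)] [NeZero d] {Cp J K : Type} [Fintype Cp] [DecidableEq Cp] [Nonempty Cp]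
  [Fintype J] [Fintype K] [DecidableEq K] (S : J → ℕ) (hS : ∀ l, 1 ≤ S l) (hdivS : ∀ l i, S l ∣ N i) (lvl : K → J)
  (zc : (k : K) → Ctr N (S (lvl k)))

/-! ## The analytic setting of `MultiscaleDecay.hc_levelOp`, as section variables (as in files 7–12) -/

variable
    (hdisj : ∀ k k' v v', cellPt S hS hdivS lvl zc k v = cellPt S hS hdivS lvl zc k' v' → k = k')
    (hcover : ∀ x : UT N, ∃ k, ∃ v : Box d (S (lvl k)), cellPt S hS hdivS lvl zc k v = x)
    (Rm : UT N × Fin d → Cp → Cp → ℝ) (hRm : ∀ b i j, ∑ k, Rm b k i * Rm b k j = if i = j then (1 : ℝ) else 0)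
    (T : J → UT N → Cp → Cp → ℝ) (hT : ∀ l x i i', ∑ k, T l x k i * T l x k i' = if i = i' then (1 : ℝ) else 0)
    (a : J → ℝ) (ha : ∀ j, 0 ≤ a j) (ω : J → UT N → ℝ)
    (hsupp : ∀ l x, ω l (ctrU N (S l) (tblk (hS l) (hdivS l) x)) ≠ 0 → ∃ k v, lvl k = l ∧ cellPt S hS hdivS lvl zc k v = x)
    {amax : ℝ} (hamax : 0 ≤ amax)
    (hscale : ∀ k, a (lvl k) * ω (lvl k) (ctrU N (S (lvl k)) (zc k)) ^ 2 * (S (lvl k) : ℝ) ^ d ≤ amax / (S (lvl k) : ℝ) ^ 2)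
    (c : UT N × Fin d → ℝ) {cmax : ℝ} (hc : ∀ b, |c b| ≤ cmax) {C : ℝ}
    (hcoer : ∀ f : UT N × Cp → ℝ,
      C * ∑ k, ((S (lvl k) : ℝ) ^ 2)⁻¹ * ∑ v : Box d (S (lvl k)), ∑ i, f (cellPt S hS hdivS lvl zc k v, i) ^ 2 ≤
        ∑ p, f p * levelOp bsrc btgt c Rm (fun l x => ctrU N (S l) (tblk (hS l) (hdivS l) x))
          (fun l x => ω l (ctrU N (S l) (tblk (hS l) (hdivS l) x))) T a f p)
    {κ : ℝ} (hκ0 : 0 ≤ κ) (hκ1 : κ ≤ 1)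

include hdisj hRm hT ha hsupp hamax hscale hc hcoer hκ0 hκ1

/-! ## §2 The global member from the local one and an abstract growth clause -/

/-- **THE GLOBAL MEMBER (3.47)₁'s SHAPE FOR `levelOp` FROM AN ABSTRACT GROWTH CLAUSE.**  Setting of `hc_levelOp`; graded level sides
`S_l = L^{e_l}` (`1 ≤ L`, `0 < R`) with the sitewise additive datum; `(1 + d/2)·log L/R ≤ κ`; file 9b's LOCAL-REGULARITY DATUM `hreg`
(a HYPOTHESIS); a real exponent `γ` with `δ := κ − (1 + d/2)·log L/R − |γ|·log L/R ≥ 0`; a GROWTH clause on the cell family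
`#{k′ : d_n(t_k,t_{k′}) < m} ≤ N₀Λ^m` for every cell `k` with `Λe^{−δ} < 1`.  Then for EVERY `u` with `|u(q)| ≤ n(q)^γ·U` (`U ≥ 0`: the
(3.41)-type weighted size of `u`) and every `p = (x,i)`:
`|((levelOp)⁻¹u)(p)| ≤ B_sup·(L^A)^{|γ|}·e^{2dδ}·(N₀Λ/(1 − Λe^{−δ}))·n(x)²·n(x)^γ·U`, `B_sup = c₁K₁ + c₂K₂` of file 9b — i.e.
`|G′u|_{(2+γ)} ≲ |u|_{(γ)}`.  Proof: `u = Σ_{k′}u·1_{cell k′}`, linearity of `(levelOp)⁻¹`, file 9b per source cell with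
`m_{k′} = S_{l_{k′}}^γ·U`, `rpow_exchange` at `(t_{k′}, x)`, K4's corner threshold `d_n(x,t_{k′}) ≥ d_n(t_{k_x},t_{k′}) − 2d`, and
beta-d4-p2's `sum_exp_neg_le_of_growth`. [cite: Balaban1985BackgroundPropagators, (3.47) p.398 + (3.41)-(3.42) p.397; Balaban1984PropagatorsII, Lemma 2.1 (2.61) p.234] [folklore] -/
theorem real_global_levelOp_inverse_le_of_growth
    (hμ : 0 < C - 2 * d * cmax ^ 2 * κ ^ 2 - amax * (Real.exp (2 * d * κ) - 1))
    {L : ℕ} (hL : 1 ≤ L) (e : J → ℕ) (hSe : ∀ l, S l = L ^ e l) {R : ℝ} (hR : 0 < R) {A : ℕ}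
    (hadd : ∀ x y : UT N, |(e (lvl (cellOf S hS hdivS lvl zc hcover x)) : ℝ) - e (lvl (cellOf S hS hdivS lvl zc hcover y))| ≤
      A + sdist bsrc btgt (siteScale S hS hdivS lvl zc hcover) x y / R)
    (hrate : (1 + d / 2) * (Real.log L / R) ≤ κ)
    {c₁ c₂ ρ₀ : ℝ} (hc₁ : 0 ≤ c₁) (hc₂ : 0 ≤ c₂)
    (hreg : ∀ (f : UT N × Cp → ℝ) (p : UT N × Cp) (m' : ℝ),
      (∀ q : UT N × Cp, sdist bsrc btgt (siteScale S hS hdivS lvl zc hcover) q.1 p.1 ≤ ρ₀ →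
        |levelOp bsrc btgt c Rm (fun l x => ctrU N (S l) (tblk (hS l) (hdivS l) x))
          (fun l x => ω l (ctrU N (S l) (tblk (hS l) (hdivS l) x))) T a f q| ≤ m') →
      |f p| ≤ c₁ * Real.sqrt (((siteScale S hS hdivS lvl zc hcover p.1 : ℝ) ^ d)⁻¹ *
          ∑ q ∈ univ.filter (fun q : UT N × Cp => sdist bsrc btgt (siteScale S hS hdivS lvl zc hcover) q.1 p.1 ≤ ρ₀), f q ^ 2) +
        c₂ * (siteScale S hS hdivS lvl zc hcover p.1 : ℝ) ^ 2 * m')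
    {γ : ℝ} (hδ : 0 ≤ κ - (1 + d / 2) * (Real.log L / R) - |γ| * (Real.log L / R))
    {N₀ Λ : ℝ} (hN₀ : 0 ≤ N₀) (hΛ : 0 ≤ Λ)
    (hcount : ∀ (k : K) (m : ℕ), ((univ.filter fun k' => sdist bsrc btgt (siteScale S hS hdivS lvl zc hcover)
        (ctrU N (S (lvl k)) (zc k)) (ctrU N (S (lvl k')) (zc k')) < m).card : ℝ) ≤ N₀ * Λ ^ m)
    (hq : Λ * Real.exp (-(κ - (1 + d / 2) * (Real.log L / R) - |γ| * (Real.log L / R))) < 1)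
    (u : UT N × Cp → ℝ) {U : ℝ} (hU : 0 ≤ U) (hu : ∀ q, |u q| ≤ (siteScale S hS hdivS lvl zc hcover q.1 : ℝ) ^ γ * U)
    (p : UT N × Cp) :
    |(Ring.inverse (levelOp bsrc btgt c Rm (fun l x => ctrU N (S l) (tblk (hS l) (hdivS l) x))
        (fun l x => ω l (ctrU N (S l) (tblk (hS l) (hdivS l) x))) T a)) u p| ≤
      (c₁ * (Real.sqrt (Fintype.card Cp) * Real.exp (κ * (ρ₀ + 2 * d)) *
            ((L : ℝ) ^ A * Real.exp (Real.log L / R * ρ₀)) * (L : ℝ) ^ A * Real.sqrt (((L : ℝ) ^ A) ^ d) /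
            (C - 2 * d * cmax ^ 2 * κ ^ 2 - amax * (Real.exp (2 * d * κ) - 1))) +
          c₂ * Real.exp ((κ - (1 + d / 2) * (Real.log L / R)) * (ρ₀ + 2 * d))) *
        ((L : ℝ) ^ A) ^ |γ| * Real.exp (2 * d * (κ - (1 + d / 2) * (Real.log L / R) - |γ| * (Real.log L / R))) *
        (N₀ * Λ / (1 - Λ * Real.exp (-(κ - (1 + d / 2) * (Real.log L / R) - |γ| * (Real.log L / R))))) *
        (siteScale S hS hdivS lvl zc hcover p.1 : ℝ) ^ 2 * (siteScale S hS hdivS lvl zc hcover p.1 : ℝ) ^ γ * U := by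
  classical
  -- the decomposition of the source over cells
  set uk : K → UT N × Cp → ℝ := fun k' q => if cellOf S hS hdivS lvl zc hcover q.1 = k' then u q else 0 with huk
  -- file 9b per source cell, BEFORE the abbreviations
  have h9b : ∀ k', |(Ring.inverse (levelOp bsrc btgt c Rm (fun l x => ctrU N (S l) (tblk (hS l) (hdivS l) x))
        (fun l x => ω l (ctrU N (S l) (tblk (hS l) (hdivS l) x))) T a)) (uk k') p| ≤
      (c₁ * (Real.sqrt (Fintype.card Cp) * Real.exp (κ * (ρ₀ + 2 * d)) *
            ((L : ℝ) ^ A * Real.exp (Real.log L / R * ρ₀)) * (L : ℝ) ^ A * Real.sqrt (((L : ℝ) ^ A) ^ d) /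
            (C - 2 * d * cmax ^ 2 * κ ^ 2 - amax * (Real.exp (2 * d * κ) - 1))) +
          c₂ * Real.exp ((κ - (1 + d / 2) * (Real.log L / R)) * (ρ₀ + 2 * d))) *
        (siteScale S hS hdivS lvl zc hcover p.1 : ℝ) ^ 2 *
        Real.exp (-((κ - (1 + d / 2) * (Real.log L / R)) *
          sdist bsrc btgt (siteScale S hS hdivS lvl zc hcover) p.1 (ctrU N (S (lvl k')) (zc k')))) *
        ((S (lvl k') : ℝ) ^ γ * U) := by
    intro k'
    refine real_sup_levelOp_inverse_le_of_regularity S hS hdivS lvl zc hdisj hcover Rm hRm T hT a ha ω hsupp hamax hscale c hc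
      hcoer hκ0 hκ1 hμ hL e hSe hR hadd hrate hc₁ hc₂ hreg k' (uk k') (fun q hq => by simp only [huk, if_neg hq])
      (mul_nonneg (Real.rpow_nonneg (Nat.cast_nonneg _) γ) hU) (fun q => ?_) p
    by_cases hq : cellOf S hS hdivS lvl zc hcover q.1 = k'
    · simp only [huk, hq, if_true]
      have h := hu q
      have hn : (siteScale S hS hdivS lvl zc hcover q.1 : ℝ) = S (lvl k') := by rw [siteScale, hq]
      rwa [hn] at h
    · simp only [huk, hq, if_false, abs_zero]
      exact mul_nonneg (Real.rpow_nonneg (Nat.cast_nonneg _) γ) hU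
  -- abbreviations
  set μ₀ := C - 2 * d * cmax ^ 2 * κ ^ 2 - amax * (Real.exp (2 * d * κ) - 1) with hμ₀
  set Aop := levelOp bsrc btgt c Rm (fun l x => ctrU N (S l) (tblk (hS l) (hdivS l) x))
    (fun l x => ω l (ctrU N (S l) (tblk (hS l) (hdivS l) x))) T a with hAop
  set n := siteScale S hS hdivS lvl zc hcover with hn
  set t : ℝ := Real.log L / R with ht
  set Bsup : ℝ := c₁ * (Real.sqrt (Fintype.card Cp) * Real.exp (κ * (ρ₀ + 2 * d)) *
      ((L : ℝ) ^ A * Real.exp (t * ρ₀)) * (L : ℝ) ^ A * Real.sqrt (((L : ℝ) ^ A) ^ d) / μ₀) +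
    c₂ * Real.exp ((κ - (1 + d / 2) * t) * (ρ₀ + 2 * d)) with hBsup
  set κ₂ : ℝ := κ - (1 + d / 2) * t with hκ₂
  set δ : ℝ := κ - (1 + d / 2) * t - |γ| * t with hδdef
  set x := p.1 with hx
  set G := Ring.inverse Aop with hG
  set D : K → ℝ := fun k' => sdist bsrc btgt n x (ctrU N (S (lvl k')) (zc k')) with hD
  set Dc : K → ℝ := fun k' => sdist bsrc btgt n (ctrU N (S (lvl (cellOf S hS hdivS lvl zc hcover x))) (zc (cellOf S hS hdivS lvl zc hcover x)))
    (ctrU N (S (lvl k')) (zc k')) with hDc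
  have hL0 : (0 : ℝ) < L := by exact_mod_cast hL
  have hLA : (1 : ℝ) ≤ (L : ℝ) ^ A := one_le_pow₀ (by exact_mod_cast hL)
  have ht0 : 0 ≤ t := div_nonneg (Real.log_nonneg (by exact_mod_cast hL)) hR.le
  have hnpos : ∀ y, (0 : ℝ) < (n y : ℝ) := fun y => by exact_mod_cast one_le_siteScale S hS hdivS lvl zc hcover y
  have hSpos : ∀ l, (0 : ℝ) < (S l : ℝ) := fun l => by exact_mod_cast hS l
  have hBsup0 : 0 ≤ Bsup := by positivity
  have hδκ : δ = κ₂ - |γ| * t := by rw [hδdef, hκ₂]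
  -- the grading at the corners
  have hgr : ∀ y, n y = L ^ (e (lvl (cellOf S hS hdivS lvl zc hcover y))) := fun y => by rw [hn, siteScale, hSe]
  have hk' : ∀ k', cellOf S hS hdivS lvl zc hcover (ctrU N (S (lvl k')) (zc k')) = k' := fun k' => by
    rw [← cubePt_zero (hS (lvl k')) (hdivS (lvl k')) (zc k')]
    exact cellOf_cellPt S hS hdivS lvl zc hdisj hcover k' _
  have hntk' : ∀ k', (n (ctrU N (S (lvl k')) (zc k')) : ℝ) = S (lvl k') := fun k' => by
    rw [hn, siteScale_ctrU S hS hdivS lvl zc hdisj hcover k']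
  -- the exchange of the real power at `(t_{k′}, x)`
  have hexch : ∀ k', ((S (lvl k') : ℝ)) ^ γ ≤ ((L : ℝ) ^ A * Real.exp (t * D k')) ^ |γ| * (n x : ℝ) ^ γ := by
    intro k'
    have h1 := scale_le_scale_mul_exp_add bsrc btgt n hL (fun y => e (lvl (cellOf S hS hdivS lvl zc hcover y))) hgr (A := A)
      (hadd x (ctrU N (S (lvl k')) (zc k')))
    have h2 := scale_le_scale_mul_exp_add bsrc btgt n hL (fun y => e (lvl (cellOf S hS hdivS lvl zc hcover y))) hgr (A := A)
      (hadd (ctrU N (S (lvl k')) (zc k')) x)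
    rw [hntk'] at h1 h2
    rw [sdist_comm bsrc btgt n (ctrU N (S (lvl k')) (zc k')) x] at h2
    have h1' : (S (lvl k') : ℝ) ≤ ((L : ℝ) ^ A * Real.exp (t * D k')) * n x := by
      calc (S (lvl k') : ℝ) ≤ (L : ℝ) ^ A * n x * Real.exp (Real.log L / R * sdist bsrc btgt n x (ctrU N (S (lvl k')) (zc k'))) := h1
        _ = ((L : ℝ) ^ A * Real.exp (t * D k')) * n x := by simp only [ht, hD]; ring
    have h2' : (n x : ℝ) ≤ ((L : ℝ) ^ A * Real.exp (t * D k')) * S (lvl k') := by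
      calc (n x : ℝ) ≤ (L : ℝ) ^ A * S (lvl k') * Real.exp (Real.log L / R * sdist bsrc btgt n x (ctrU N (S (lvl k')) (zc k'))) := h2
        _ = ((L : ℝ) ^ A * Real.exp (t * D k')) * S (lvl k') := by simp only [ht, hD]; ring
    have hC1 : (1 : ℝ) ≤ (L : ℝ) ^ A * Real.exp (t * D k') := by
      have : (1 : ℝ) ≤ Real.exp (t * D k') := Real.one_le_exp_iff.mpr (mul_nonneg ht0 (sdist_nonneg bsrc btgt n _ _))
      nlinarith
    exact rpow_exchange (hSpos _) (hnpos x) hC1 h1' h2'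
  -- per source cell: the summand of the final bound
  have hterm : ∀ k', |G (uk k') p| ≤ Bsup * ((L : ℝ) ^ A) ^ |γ| * Real.exp (2 * d * δ) * (n x : ℝ) ^ 2 * (n x : ℝ) ^ γ * U *
      Real.exp (-(δ * Dc k')) := by
    intro k'
    have h0 : |G (uk k') p| ≤ Bsup * (n x : ℝ) ^ 2 * Real.exp (-(κ₂ * D k')) * ((S (lvl k') : ℝ) ^ γ * U) := by
      have := h9b k'
      simpa only [hG, hAop, hn, hx, ht, hBsup, hκ₂, hμ₀, hD] using this
    -- exchange the power
    have h1 : ((S (lvl k') : ℝ)) ^ γ * U ≤ ((L : ℝ) ^ A * Real.exp (t * D k')) ^ |γ| * (n x : ℝ) ^ γ * U :=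
      mul_le_mul_of_nonneg_right (hexch k') hU
    have hpre : 0 ≤ Bsup * (n x : ℝ) ^ 2 * Real.exp (-(κ₂ * D k')) := by positivity
    have h2 := mul_le_mul_of_nonneg_left h1 hpre
    -- `(L^A e^{tD})^{|γ|} = (L^A)^{|γ|} e^{|γ| t D}` and `e^{−κ₂D} e^{|γ|tD} = e^{−δD}`
    have hsplit : ((L : ℝ) ^ A * Real.exp (t * D k')) ^ |γ| = ((L : ℝ) ^ A) ^ |γ| * Real.exp (|γ| * (t * D k')) := by
      rw [Real.mul_rpow (pow_nonneg hL0.le A) (Real.exp_pos _).le, ← Real.exp_mul, mul_comm (t * D k') |γ|]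
    have hexpc : Real.exp (-(κ₂ * D k')) * Real.exp (|γ| * (t * D k')) = Real.exp (-(δ * D k')) := by
      rw [← Real.exp_add, hδκ]; congr 1; ring
    -- the corner threshold: `D k′ ≥ Dc k′ − 2d`
    have hthr : Dc k' - 2 * d ≤ D k' := by
      have h := (sdist_corner_thresholds S hS hdivS lvl zc hdisj hcover x k').2
      simpa only [hD, hDc, hn] using h
    have hδ0 : 0 ≤ δ := by rw [hδdef, ht]; exact hδ
    have hmono : Real.exp (-(δ * D k')) ≤ Real.exp (2 * d * δ) * Real.exp (-(δ * Dc k')) := by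
      rw [← Real.exp_add]
      exact Real.exp_le_exp.mpr (by nlinarith)
    calc |G (uk k') p| ≤ Bsup * (n x : ℝ) ^ 2 * Real.exp (-(κ₂ * D k')) * (((L : ℝ) ^ A * Real.exp (t * D k')) ^ |γ| * (n x : ℝ) ^ γ * U) :=
          h0.trans h2
      _ = Bsup * ((L : ℝ) ^ A) ^ |γ| * (n x : ℝ) ^ 2 * (n x : ℝ) ^ γ * U *
            (Real.exp (-(κ₂ * D k')) * Real.exp (|γ| * (t * D k'))) := by rw [hsplit]; ring
      _ = Bsup * ((L : ℝ) ^ A) ^ |γ| * (n x : ℝ) ^ 2 * (n x : ℝ) ^ γ * U * Real.exp (-(δ * D k')) := by rw [hexpc]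
      _ ≤ Bsup * ((L : ℝ) ^ A) ^ |γ| * (n x : ℝ) ^ 2 * (n x : ℝ) ^ γ * U * (Real.exp (2 * d * δ) * Real.exp (-(δ * Dc k'))) :=
          mul_le_mul_of_nonneg_left hmono (by positivity)
      _ = _ := by ring
  -- the lattice sum over source cells (beta-d4-p2's growth summation)
  have hsum : ∑ k', Real.exp (-(δ * Dc k')) ≤ N₀ * Λ / (1 - Λ * Real.exp (-δ)) := by
    have hδ0 : 0 ≤ δ := by rw [hδdef, ht]; exact hδ
    have hq' : Λ * Real.exp (-δ) < 1 := by simpa only [hδdef, ht] using hq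
    exact sum_exp_neg_le_of_growth Dc (fun k' => sdist_nonneg bsrc btgt n _ _) hN₀ hΛ
      (fun m => by simpa only [hDc, hn] using hcount (cellOf S hS hdivS lvl zc hcover x) m) hδ0 hq'
  -- assemble: decomposition + linearity + triangle inequality
  have hdec : u = ∑ k', uk k' := by
    funext q
    rw [Finset.sum_apply]
    simp only [huk]
    rw [Finset.sum_ite_eq]
    simp
  have hlin : G u p = ∑ k', G (uk k') p := by
    rw [hdec, map_sum, Finset.sum_apply]
  rw [hlin]
  have hK : 0 ≤ Bsup * ((L : ℝ) ^ A) ^ |γ| * Real.exp (2 * d * δ) * (n x : ℝ) ^ 2 * (n x : ℝ) ^ γ * U := by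
    have : 0 ≤ (n x : ℝ) ^ γ := Real.rpow_nonneg (hnpos x).le γ
    positivity
  calc |∑ k', G (uk k') p| ≤ ∑ k', |G (uk k') p| := Finset.abs_sum_le_sum_abs _ _
    _ ≤ ∑ k', Bsup * ((L : ℝ) ^ A) ^ |γ| * Real.exp (2 * d * δ) * (n x : ℝ) ^ 2 * (n x : ℝ) ^ γ * U * Real.exp (-(δ * Dc k')) :=
        Finset.sum_le_sum fun k' _ => hterm k'
    _ = Bsup * ((L : ℝ) ^ A) ^ |γ| * Real.exp (2 * d * δ) * (n x : ℝ) ^ 2 * (n x : ℝ) ^ γ * U * ∑ k', Real.exp (-(δ * Dc k')) := by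
        rw [Finset.mul_sum]
    _ ≤ Bsup * ((L : ℝ) ^ A) ^ |γ| * Real.exp (2 * d * δ) * (n x : ℝ) ^ 2 * (n x : ℝ) ^ γ * U * (N₀ * Λ / (1 - Λ * Real.exp (-δ))) :=
        mul_le_mul_of_nonneg_left hsum hK
    _ = _ := by simp only [hBsup, hδdef, ht, hμ₀]; ring

/-! ## §3 The growth clause DISCHARGED by the grading (beta-d4-p3's `cell_growth_add`) -/

/-- **THE GLOBAL MEMBER (3.47)₁'s SHAPE FOR `levelOp`, growth clause discharged**: as `real_global_levelOp_inverse_le_of_growth` with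
`N₀ = (3(L^A)²)^d·(d!/ε^d)·e^{2d(ε + (log L/R)d)}`, `Λ = e^{ε + 2(log L/R)d}` supplied by beta-d4-p3's `MultiscaleGrowthCells.cell_growth_add`
from the SAME sitewise additive datum (free `ε > 0`); the remaining DATA are the cube partition with graded levels, the additive datum
(itself a theorem of the (2.2)-separation shape, `MultiscaleNestedGrading.abs_level_sub_le`) and file 9b's `hreg`.
[cite: Balaban1985BackgroundPropagators, (3.47) p.398; Balaban1984PropagatorsII, Lemma 2.1 (2.61) p.234 + (2.1)-(2.2) p.224] [folklore] -/
theorem real_global_levelOp_inverse_le_of_grading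
    (hμ : 0 < C - 2 * d * cmax ^ 2 * κ ^ 2 - amax * (Real.exp (2 * d * κ) - 1))
    {L : ℕ} (hL : 1 ≤ L) (e : J → ℕ) (hSe : ∀ l, S l = L ^ e l) {R : ℝ} (hR : 0 < R) {A : ℕ}
    (hadd : ∀ x y : UT N, |(e (lvl (cellOf S hS hdivS lvl zc hcover x)) : ℝ) - e (lvl (cellOf S hS hdivS lvl zc hcover y))| ≤
      A + sdist bsrc btgt (siteScale S hS hdivS lvl zc hcover) x y / R)
    (hrate : (1 + d / 2) * (Real.log L / R) ≤ κ)
    {c₁ c₂ ρ₀ : ℝ} (hc₁ : 0 ≤ c₁) (hc₂ : 0 ≤ c₂)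
    (hreg : ∀ (f : UT N × Cp → ℝ) (p : UT N × Cp) (m' : ℝ),
      (∀ q : UT N × Cp, sdist bsrc btgt (siteScale S hS hdivS lvl zc hcover) q.1 p.1 ≤ ρ₀ →
        |levelOp bsrc btgt c Rm (fun l x => ctrU N (S l) (tblk (hS l) (hdivS l) x))
          (fun l x => ω l (ctrU N (S l) (tblk (hS l) (hdivS l) x))) T a f q| ≤ m') →
      |f p| ≤ c₁ * Real.sqrt (((siteScale S hS hdivS lvl zc hcover p.1 : ℝ) ^ d)⁻¹ *
          ∑ q ∈ univ.filter (fun q : UT N × Cp => sdist bsrc btgt (siteScale S hS hdivS lvl zc hcover) q.1 p.1 ≤ ρ₀), f q ^ 2) +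
        c₂ * (siteScale S hS hdivS lvl zc hcover p.1 : ℝ) ^ 2 * m')
    {γ : ℝ} (hδ : 0 ≤ κ - (1 + d / 2) * (Real.log L / R) - |γ| * (Real.log L / R)) {ε : ℝ} (hε : 0 < ε)
    (hq : Real.exp (ε + 2 * (Real.log L / R) * d) *
      Real.exp (-(κ - (1 + d / 2) * (Real.log L / R) - |γ| * (Real.log L / R))) < 1)
    (u : UT N × Cp → ℝ) {U : ℝ} (hU : 0 ≤ U) (hu : ∀ q, |u q| ≤ (siteScale S hS hdivS lvl zc hcover q.1 : ℝ) ^ γ * U)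
    (p : UT N × Cp) :
    |(Ring.inverse (levelOp bsrc btgt c Rm (fun l x => ctrU N (S l) (tblk (hS l) (hdivS l) x))
        (fun l x => ω l (ctrU N (S l) (tblk (hS l) (hdivS l) x))) T a)) u p| ≤
      (c₁ * (Real.sqrt (Fintype.card Cp) * Real.exp (κ * (ρ₀ + 2 * d)) *
            ((L : ℝ) ^ A * Real.exp (Real.log L / R * ρ₀)) * (L : ℝ) ^ A * Real.sqrt (((L : ℝ) ^ A) ^ d) /
            (C - 2 * d * cmax ^ 2 * κ ^ 2 - amax * (Real.exp (2 * d * κ) - 1))) +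
          c₂ * Real.exp ((κ - (1 + d / 2) * (Real.log L / R)) * (ρ₀ + 2 * d))) *
        ((L : ℝ) ^ A) ^ |γ| * Real.exp (2 * d * (κ - (1 + d / 2) * (Real.log L / R) - |γ| * (Real.log L / R))) *
        ((3 * ((L : ℝ) ^ A) ^ 2) ^ d * ((d.factorial : ℝ) / ε ^ d) * Real.exp (2 * d * (ε + Real.log L / R * d)) *
            Real.exp (ε + 2 * (Real.log L / R) * d) /
          (1 - Real.exp (ε + 2 * (Real.log L / R) * d) *
            Real.exp (-(κ - (1 + d / 2) * (Real.log L / R) - |γ| * (Real.log L / R))))) *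
        (siteScale S hS hdivS lvl zc hcover p.1 : ℝ) ^ 2 * (siteScale S hS hdivS lvl zc hcover p.1 : ℝ) ^ γ * U := by
  have hgr : ∀ y, siteScale S hS hdivS lvl zc hcover y = L ^ (e (lvl (cellOf S hS hdivS lvl zc hcover y))) := fun y => by
    rw [siteScale, hSe]
  have hcount := fun (k : K) (m : ℕ) =>
    cell_growth_add S hS hdivS lvl zc hdisj hcover hL (fun y => e (lvl (cellOf S hS hdivS lvl zc hcover y))) hgr hR (A := A)
      hadd hε k m
  exact real_global_levelOp_inverse_le_of_growth S hS hdivS lvl zc hdisj hcover Rm hRm T hT a ha ω hsupp hamax hscale c hc hcoer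
    hκ0 hκ1 hμ hL e hSe hR hadd hrate hc₁ hc₂ hreg hδ (by positivity) (Real.exp_pos _).le hcount hq u hU hu p

end

end Summit.QuantumFields.BalabanUV.Beta.MultiscaleGlobalMember
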